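import Mathlib.Analysis.InnerProductSpace.PiL2
import Literature.Geometry.Riemannian.LiQingShiPinching
import Literature.Geometry.Riemannian.WeylEnergy
import Literature.Geometry.Riemannian.EinsteinWeylZero
import Literature.Geometry.Riemannian.HyperboloidModel
import Literature.Geometry.Riemannian.SectionalPinchingEstimate
import Literature.Geometry.Lorentzian.LeviCivitaCurvature
import HarnessLib

/-!
# Li–Qing–Shi curvature pinching (Trans. AMS 369 (2017), Thm. 1.8, `n = 5`): proved complements

Companion ("Proofs") file of `Literature/Geometry/Riemannian/LiQingShiPinching.lean` for its named
fact `Literature.Geometry.Riemannian.liQingShi_pinching_five` (G. Li, J. Qing, Y. Shi, *Gap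
phenomena and curvature estimates for conformally compact Einstein manifolds*, arXiv:1410.6402,
Thm. 1.8 at bulk dimension `n = 5`: for every `ε > 0` there is `δ > 0` such that every
Poincaré–Einstein filling `(N⁵, g)` of a closed `(M⁴, [g₀])` with
`Y(M, [g₀]) ≥ (1 - δ) Y(S⁴) = (1 - δ) 8√6π` has all sectional curvatures in `[-1 - ε, -1 + ε]`).

The fact is **not** discharged here. Its printed proof (arXiv pp. 12–13) is a two-step blow-up:
(B) the relative volume inequality Thm. 1.5 (§§4–6: cut-locus analysis, Riccati comparison,
Bishop–Gromov, geodesic defining functions, `C³` asymptotic hyperbolicity via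
Chruściel–Delay–Lee–Skinner); (C) a uniform Weyl bound `|W| ≤ C` by rescaling at the maximum of
`|W|` and pointed Cheeger–Gromov–Anderson convergence of Einstein manifolds to a Ricci-flat limit
with Euclidean volume growth, hence flat; (D) a second compactness argument whose Einstein limit
has hyperbolic volume ratio `≡ 1`, hence is `ℍⁿ` (Dutta–Javaheri), contradicting
`|W|(p_∞) ≥ ε₀`; together with (E) the value `Y(S⁴, [g_S]) = 8√6π` (Aubin/Obata). None of
(B)–(E) — geodesic distance functions, cut loci, pointed convergence of Riemannian manifolds, the
compactness and rigidity theorems, the Yamabe constant of the round sphere — is available in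
Mathlib or in this tree, so the theorem stays a named fact (SIZE XL in the provefact census).

What this file PROVES is the part of the argument that the tree's vocabulary supports:

* (A) **The pointwise dictionary between the statement and the proof.** The theorem is stated for
  sectional curvatures, `|K + 1| ≤ ε`, while its proof bounds the Weyl tensor (`|W|[g⁺] ≤ C`,
  `|W|(p_j) ≥ ε₀`). For an Einstein metric `Ric = λ g` on an `m`-manifold, `m ≥ 3`, the
  orthonormal-frame Weyl component (`PseudoRiemannianMetric.weylFrame`, `WeylEnergy.lean`;
  Besse 1987, (1.116)) on a pair is `W_{ijji} = K(eᵢ, eⱼ) - λ/(m-1)`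
  (`weylFrame_pair_of_ricci_eq`: `Ric_{ab} = λ δ_{ab}`, `S = m λ` by
  `scalarCurvature_eq_of_ricci_eq`); for `Ric = -(m-1) g` this is `W_{ijji} = K_{ij} + 1`, and for
  a Poincaré–Einstein filling (`Ric = -4 g`, `m = 5`) `W_{ijji} = Rm(eᵢ, eⱼ, eⱼ, eᵢ) + 1`
  (`IsPoincareEinsteinFilling.weylFrame_pair_eq`), `S ≡ -20`
  (`IsPoincareEinsteinFilling.scalarCurvature_eq`).
* **No junk curvature on a Poincaré–Einstein filling**: `Ric = -4 g ≠ 0` forces the curvature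
  tensor of the Levi-Civita connection to exist (`CurvatureTensorialAt`) at every bulk point
  (`IsPoincareEinsteinFilling.curvatureTensorialAt`), so the `curvatureForm` in the conclusion of
  the fact is the genuine Riemann tensor, never the junk value `0` of `Curvature.lean`.
* **Orthonormal extension** (`exists_isOrthonormalFrame_extend`): for a positive definite `g_x`
  on an `m`-dimensional fibre, a family `v : Fin m → T_x M` which is `g_x`-orthonormal on
  `s ⊆ Fin m` agrees on `s` with a `g_x`-orthonormal frame `Fin m → T_x M` (Mathlib's
  `Orthonormal.exists_orthonormalBasis_extension_of_card_eq` for the inner product `g_x`); in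
  particular a `g`-orthonormal pair `X, Y` consists of the first two vectors of an orthonormal
  `5`-frame, to which the frame-wise Weyl bound applies.
* **Reduction of the fact to the form its proof delivers** (`liQingShi_pinching_five_of_weyl`):
  if for every `ε > 0` there is `δ > 0` such that every Poincaré–Einstein filling with
  `Y(M,[g₀]) ≥ (1-δ) 8√6π` (the literal hypothesis of the fact) has all orthonormal-frame Weyl
  components `|W_{ijkl}| ≤ ε` at every point — the output of steps (C)–(D) of the printed proof —
  then `liQingShi_pinching_five` holds: `|K(X,Y) + 1| = |W_{0110}| ≤ ε` in an orthonormal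
  `5`-frame extending `(X, Y)`.
* **The fact in the tree's Yamabe vocabulary** (`liQingShi_pinching_five.of_yamabeConstant_ge`):
  from the fact, the same conclusion under `(1-δ) 8√6π ≤ yamabeConstant g₀` (`YamabeConstant.lean`,
  the metric form `Y(M,[g₀]) = inf_h ∫R_h dV_h / √Vol(M,h)`), given that the Yamabe functional is
  bounded below on the class and conformal metrics have positive volume (both automatic on a closed
  manifold; hypotheses here, as in `YamabeConstant.lean`).
* **The model case pins the sign convention**: hyperbolic space (`Hyperboloid.metric`,
  `HyperboloidModel.lean`, constant curvature `-1` proved there) satisfies the conclusion with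
  `ε = 0`: `Rm(X, Y, Y, X) + 1 = 0` on orthonormal pairs (`Hyperboloid.curvatureForm_pair_add_one`)
  — with the tree's `R(X,Y) = ∇_X∇_Y - ∇_Y∇_X - ∇_{[X,Y]}` and `Rm(X,Y,Z,W) = g(R(X,Y)Z, W)` the
  pinching is around `K = -1`, as printed.
* Bookkeeping: the conclusion is monotone in `ε` and the hypothesis antitone in `δ`
  (`liQingShi_pinching_five_iff_small`: it suffices to treat `ε, δ ≤ 1`).
* **The converse, hence the equivalence of the fact with its Weyl form**
  (`liQingShi_pinching_five_iff_weyl`): on a Poincaré–Einstein filling the full frame Weyl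
  tensor is `W_{ijkl} = Rm_{ijkl} + (δ_il δ_jk - δ_ik δ_jl)` in every orthonormal `5`-frame
  (`IsPoincareEinsteinFilling.weylFrame_eq_of_isOrthonormalFrame`: `W = Rm - Rm_{ℍ}`, the
  deviation from the hyperbolic curvature tensor), so the Berger–Karcher-type estimate of
  `SectionalPinchingEstimate.lean` (sectional pinching `|K + 1| ≤ ε` on all orthonormal pairs
  bounds every component of `Rm - Rm_{-1}` by `8ε`) gives `|W_{ijkl}| ≤ 8ε`
  (`IsPoincareEinsteinFilling.abs_weylFrame_le_of_pinching`, `weyl_of_liQingShi_pinching_five`).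
  Thus the reduction `liQingShi_pinching_five_of_weyl` loses nothing: the named fact is
  EQUIVALENT to "for every `ε > 0` there is `δ > 0` such that every Poincaré–Einstein filling with
  `Y(M,[g₀]) ≥ (1-δ)·8√6π` has `|W_{ijkl}| ≤ ε` in every orthonormal frame at every point" — the
  statement the printed blow-up argument (pp. 12–13) proves.

Everything here is proved; no facts are vended.

## References

* G. Li, J. Qing, Y. Shi, Trans. Amer. Math. Soc. 369 (2017) 4385–4413, arXiv:1410.6402:
  Thm. 1.8 (p. 4), its proof (pp. 12–13), Thm. 1.5, Lemma 1.6, Def. 2.1. [LiQingShi2017]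
* A. L. Besse, *Einstein Manifolds* (1987), 1.114–1.118 (Weyl part of an Einstein curvature
  tensor). [Besse1987]
* J. M. Lee, *Introduction to Riemannian Manifolds*, 2nd ed. (2018), Thm. 8.34 (c), Prop. 8.36
  (hyperbolic space, constant curvature `-1`). [Lee2018]
* J. M. Lee, T. H. Parker, Bull. AMS 17 (1987), §1 (1.5), §3 (Yamabe constant). [LeeParker1987]
-/

noncomputable section

open Bundle MeasureTheory Module Set
open scoped Manifold ContDiff Topology ENNReal

namespace Literature.Geometry.Riemannian

open Literature.Geometry.Lorentzian (PseudoRiemannianMetric riemannianMeasure)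
open Literature.Geometry.Lorentzian.PseudoRiemannianMetric

/-! ### Pointwise linear algebra for a pseudo-Riemannian metric -/

section General

variable {E : Type*} [NormedAddCommGroup E] [NormedSpace ℝ E] {H : Type*} [TopologicalSpace H]
  {I : ModelWithCorners ℝ E H} {M : Type*} [TopologicalSpace M] [ChartedSpace H M]
  [IsManifold I ∞ M] {n : ℕ∞ω} [FiniteDimensional ℝ E]

variable (g : PseudoRiemannianMetric I n E (TangentSpace I : M → Type _))

/-- **Orthonormal extension.** If `g_x` is positive definite on `T_x M` and `dim M = m`, a family
`v : Fin m → T_x M` which is `g_x`-orthonormal on a set of indices `s` coincides on `s` with a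
`g_x`-orthonormal frame `e : Fin m → T_x M` (an orthonormal basis). Mathlib's
`Orthonormal.exists_orthonormalBasis_extension_of_card_eq` for the inner product space structure
`⟪v, w⟫ = g_x(v, w)` on the fibre (O'Neill 1983, Ch. 2, Lemma 24–25: orthonormal sets extend to
orthonormal bases). [cite: ONeill1983, Ch. 2, Lemma 24 (p. 50)] -/
theorem _root_.Literature.Geometry.Lorentzian.PseudoRiemannianMetric.exists_isOrthonormalFrame_extend
    {x : M} (hpos : ∀ v : TangentSpace I x, v ≠ 0 → 0 < g.val x v v) {m : ℕ}
    (hm : finrank ℝ E = m) (v : Fin m → TangentSpace I x) (s : Set (Fin m))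
    (h1 : ∀ i ∈ s, g.val x (v i) (v i) = 1)
    (h0 : ∀ i ∈ s, ∀ j ∈ s, i ≠ j → g.val x (v i) (v j) = 0) :
    ∃ e : Fin m → TangentSpace I x, g.IsOrthonormalFrame x e ∧ ∀ i ∈ s, e i = v i := by
  classical
  let cd : InnerProductSpace.Core ℝ (TangentSpace I x) :=
    { inner := fun v w ↦ g.val x v w
      conj_inner_symm := fun v w ↦ by simp [g.symm x v w]
      re_inner_nonneg := fun v ↦ by
        by_cases hv : v = 0
        · subst hv; simp
        · simpa using (hpos v hv).le
      add_left := fun u v w ↦ by simp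
      smul_left := fun u v r ↦ by simp
      definite := fun v hv ↦ by
        by_contra h
        exact (hpos v h).ne' hv }
  letI : NormedAddCommGroup (TangentSpace I x) :=
    @InnerProductSpace.Core.toNormedAddCommGroup ℝ _ _ _ _ cd
  letI : InnerProductSpace ℝ (TangentSpace I x) := InnerProductSpace.ofCore cd.toCore
  haveI : FiniteDimensional ℝ (TangentSpace I x) := ‹FiniteDimensional ℝ E›
  have hinner : ∀ v w : TangentSpace I x, inner ℝ v w = g.val x v w := fun _ _ ↦ rfl
  have hm' : finrank ℝ (TangentSpace I x) = Fintype.card (Fin m) := by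
    rw [Fintype.card_fin]; exact hm
  have hv : Orthonormal ℝ (s.restrict v) := by
    rw [orthonormal_iff_ite]
    rintro ⟨i, hi⟩ ⟨j, hj⟩
    simp only [restrict_apply, hinner, Subtype.mk.injEq]
    by_cases hij : i = j
    · subst hij; simp [h1 i hi]
    · simp [hij, h0 i hi j hj hij]
  obtain ⟨b, hb⟩ := hv.exists_orthonormalBasis_extension_of_card_eq hm'
  have hbo := orthonormal_iff_ite.1 b.orthonormal
  refine ⟨b, ⟨fun i ↦ ?_, fun i j hij ↦ ?_⟩, hb⟩
  · rw [← hinner, hbo i i, if_pos rfl]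
  · rw [← hinner, hbo i j, if_neg hij]

/-- In particular a `g_x`-orthonormal pair `X, Y` (positive definite `g_x`, `dim M = m ≥ 2`)
consists of the first two vectors of a `g_x`-orthonormal frame `e : Fin m → T_x M`.
[cite: ONeill1983, Ch. 2, Lemma 24 (p. 50)] -/
theorem _root_.Literature.Geometry.Lorentzian.PseudoRiemannianMetric.exists_isOrthonormalFrame_pair
    {x : M} (hpos : ∀ v : TangentSpace I x, v ≠ 0 → 0 < g.val x v v) {m : ℕ}
    (hm : finrank ℝ E = m + 2) {X Y : TangentSpace I x} (hX : g.val x X X = 1)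
    (hY : g.val x Y Y = 1) (hXY : g.val x X Y = 0) :
    ∃ e : Fin (m + 2) → TangentSpace I x, g.IsOrthonormalFrame x e ∧ e 0 = X ∧ e 1 = Y := by
  let v : Fin (m + 2) → TangentSpace I x := fun i ↦ if i = 0 then X else Y
  have h10 : (1 : Fin (m + 2)) ≠ 0 := by simp
  obtain ⟨e, he, hes⟩ := g.exists_isOrthonormalFrame_extend hpos hm v {0, 1}
    (by
      rintro i (rfl | rfl)
      · simpa [v] using hX
      · simpa [v, h10] using hY)
    (by
      rintro i (rfl | rfl) j (rfl | rfl) hij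
      · exact absurd rfl hij
      · simpa [v, h10] using hXY
      · simpa [v, h10, g.symm x Y X] using hXY
      · exact absurd rfl hij)
  refine ⟨e, he, ?_, ?_⟩
  · simpa [v] using hes 0 (by simp)
  · simpa [v, h10] using hes 1 (by simp)

variable [g.HasLeviCivita]

omit [FiniteDimensional ℝ E] in
/-- **An Einstein metric with `λ ≠ 0` has no junk curvature.** If `Ric = λ g` with `λ ≠ 0`, `g_x`
is positive definite and `T_x M ≠ 0`, then the Levi-Civita connection has a curvature tensor at
`x` (`CovariantDerivative.CurvatureTensorialAt`): otherwise `Curvature.lean` assigns the junk value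
`R_x = 0`, whence `Ric_x = 0 ≠ λ g_x`. (For `C²` metrics this holds anyway, O'Neill 1983, Ch. 3,
Lemma 3.35; the point is that the Einstein equation of the tree's `ricci` already excludes the
junk branch.) [folklore] -/
theorem curvatureTensorialAt_leviCivita_of_ricci_eq {x : M}
    (hpos : ∀ v : TangentSpace I x, v ≠ 0 → 0 < g.val x v v) {lam : ℝ} (hlam : lam ≠ 0)
    (hRic : ∀ X Y : TangentSpace I x, g.ricci x X Y = lam * g.val x X Y)
    (hx : ∃ v : TangentSpace I x, v ≠ 0) : g.leviCivita.CurvatureTensorialAt x := by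
  by_contra h
  obtain ⟨v, hv⟩ := hx
  have h0 : g.leviCivita.curvature x = 0 :=
    CovariantDerivative.curvature_of_not_curvatureTensorialAt _ h
  have hR : g.ricci x v v = 0 := by
    rw [PseudoRiemannianMetric.ricci_apply, CovariantDerivative.ricci_apply]
    have : g.leviCivita.ricciAux x v v = 0 := by
      ext w; simp [h0]
    rw [this, map_zero]
  have := hRic v v
  rw [hR] at this
  exact (mul_ne_zero hlam (hpos v hv).ne') this.symm

/-- **The Weyl tensor of an Einstein metric on an orthonormal pair** (Besse 1987, (1.116)–1.118:
for `z = Ric - (S/m) g = 0` the curvature tensor is `W + (S/(2m(m-1))) g ⊙ g`). If `g` is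
Riemannian on an `m`-manifold, `m ≥ 3`, with `Ric = λ g`, then for any frame `e` of size `m` and
indices `i ≠ j` with `eᵢ, eⱼ` `g`-orthonormal, the frame Weyl component
(`PseudoRiemannianMetric.weylFrame`) is `W_{ijji} = Rm(eᵢ, eⱼ, eⱼ, eᵢ) - λ/(m-1)`, i.e.
`K(eᵢ, eⱼ) = W_{ijji} + λ/(m-1)`: the Ricci correction contributes `-2λ/(m-2)` and the scalar
correction `S/((m-1)(m-2)) = mλ/((m-1)(m-2))` (`S = mλ`, `scalarCurvature_eq_of_ricci_eq`).
[cite: Besse1987, (1.116)–1.118] -/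
theorem weylFrame_pair_of_ricci_eq (hg : g.IsRiemannian) {m : ℕ} (hm : finrank ℝ E = m)
    (h3 : 3 ≤ m) {lam : ℝ}
    (hRic : ∀ (x : M) (X Y : TangentSpace I x), g.ricci x X Y = lam * g.val x X Y) (x : M)
    {ι : Type*} [Fintype ι] [DecidableEq ι] (hι : Fintype.card ι = m) (e : ι → TangentSpace I x)
    {i j : ι} (hij : i ≠ j) (hi : g.val x (e i) (e i) = 1) (hj : g.val x (e j) (e j) = 1)
    (hij0 : g.val x (e i) (e j) = 0) :
    g.weylFrame x e i j j i =
      g.curvatureForm g.leviCivita x (e i) (e j) (e j) (e i) - lam / (m - 1) := by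
  have hS := scalarCurvature_eq_of_ricci_eq g hg hm hRic x
  have hji0 : g.val x (e j) (e i) = 0 := by rw [g.symm]; exact hij0
  have h3' : (3 : ℝ) ≤ m := by exact_mod_cast h3
  have hm1 : (m : ℝ) - 1 ≠ 0 := by linarith
  have hm2 : (m : ℝ) - 2 ≠ 0 := by linarith
  rw [weylFrame_apply, hι, hS]
  simp [hRic, hi, hj, hij0, hji0, hij, hij.symm]
  field_simp
  ring

/-- **`Ric = -(m-1) g` (the Einstein normalisation of hyperbolic space): `W_{ijji} = K_{ij} + 1`**
on orthonormal pairs — the identity by which a bound on the Weyl tensor of a conformally compact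
Einstein manifold is a pinching of its sectional curvatures around `-1` (Li–Qing–Shi 2017, proof
of Thm. 1.8, pp. 12–13, where `|W| → 0` is shown). [cite: Besse1987, (1.116)–1.118] -/
theorem weylFrame_pair_of_ricci_eq_neg (hg : g.IsRiemannian) {m : ℕ} (hm : finrank ℝ E = m)
    (h3 : 3 ≤ m)
    (hRic : ∀ (x : M) (X Y : TangentSpace I x), g.ricci x X Y = -((m : ℝ) - 1) * g.val x X Y)
    (x : M) {ι : Type*} [Fintype ι] [DecidableEq ι] (hι : Fintype.card ι = m)
    (e : ι → TangentSpace I x) {i j : ι} (hij : i ≠ j) (hi : g.val x (e i) (e i) = 1)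
    (hj : g.val x (e j) (e j) = 1) (hij0 : g.val x (e i) (e j) = 0) :
    g.weylFrame x e i j j i = g.curvatureForm g.leviCivita x (e i) (e j) (e j) (e i) + 1 := by
  have h3' : (3 : ℝ) ≤ m := by exact_mod_cast h3
  have hm1 : (m : ℝ) - 1 ≠ 0 := by linarith
  rw [weylFrame_pair_of_ricci_eq g hg hm h3 hRic x hι e hij hi hj hij0, neg_div, div_self hm1,
    sub_neg_eq_add]

end General

/-! ### Poincaré–Einstein fillings of a closed `4`-manifold (`Ric = -4 g`, `dim N = 5`) -/

section Filling

variable {M : Type} [TopologicalSpace M] [ChartedSpace (EuclideanSpace ℝ (Fin 4)) M]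
  [IsManifold (𝓡 4) ∞ M]
  {g₀ : Bundle.ContMDiffRiemannianMetric (𝓡 4) ∞ (EuclideanSpace ℝ (Fin 4))
    (TangentSpace (𝓡 4) : M → Type _)}
  {N : Type} [TopologicalSpace N] [ChartedSpace (EuclideanSpace ℝ (Fin 5)) N]
  [IsManifold (𝓡 5) ∞ N]
  {g : Bundle.ContMDiffRiemannianMetric (𝓡 5) ∞ (EuclideanSpace ℝ (Fin 5))
    (TangentSpace (𝓡 5) : N → Type _)}
  [(PseudoRiemannianMetric.ofRiemannian g).HasLeviCivita]

/-- The Einstein equation of a Poincaré–Einstein filling, evaluated: `Ric(X, Y) = -4 g(X, Y)`.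
[cite: LiQingShi2017, Def. 2.1] -/
theorem IsPoincareEinsteinFilling.ricci_apply (h : IsPoincareEinsteinFilling M g₀ N g) (x : N)
    (X Y : TangentSpace (𝓡 5) x) :
    (ofRiemannian g).ricci x X Y = -4 * (ofRiemannian g).val x X Y := by
  rw [h.ricci_eq x]
  simp

/-- **The scalar curvature of a Poincaré–Einstein filling is `S ≡ -20`** (`S = tr_g Ric = 5·(-4)`;
Li–Qing–Shi 2017, §2: `R[g⁺] = -n(n-1)` for `Ric[g⁺] = -(n-1) g⁺`, here `n = 5`).
[cite: LiQingShi2017, §2 (p. 6)] -/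
theorem IsPoincareEinsteinFilling.scalarCurvature_eq (h : IsPoincareEinsteinFilling M g₀ N g)
    (x : N) : (ofRiemannian g).scalarCurvature x = -20 := by
  have := scalarCurvature_eq_of_ricci_eq (ofRiemannian g) (isRiemannian_ofRiemannian g)
    (m := 5) finrank_euclideanSpace_fin h.ricci_apply x
  rw [this]; norm_num

/-- **No junk curvature on a Poincaré–Einstein filling**: `Ric = -4 g ≠ 0` forces the Levi-Civita
connection of `g` to have a genuine curvature tensor (`CurvatureTensorialAt`) at every point of
the bulk, so the `curvatureForm` in `liQingShi_pinching_five` is never the junk value `0` of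
`Curvature.lean`. [folklore] -/
theorem IsPoincareEinsteinFilling.curvatureTensorialAt (h : IsPoincareEinsteinFilling M g₀ N g)
    (x : N) : (ofRiemannian g).leviCivita.CurvatureTensorialAt x := by
  obtain ⟨b, -⟩ := (ofRiemannian g).exists_basis_isOrthonormalFrame (x := x)
    (fun v hv ↦ isRiemannian_ofRiemannian g x v hv) (m := 5) finrank_euclideanSpace_fin
  exact curvatureTensorialAt_leviCivita_of_ricci_eq (ofRiemannian g)
    (fun v hv ↦ isRiemannian_ofRiemannian g x v hv) (lam := -4) (by norm_num) (h.ricci_apply x)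
    ⟨b 0, b.ne_zero 0⟩

/-- **`W_{ijji} = Rm(eᵢ, eⱼ, eⱼ, eᵢ) + 1` on a Poincaré–Einstein filling** (`Ric = -4 g`,
`dim N = 5`): for any `5`-frame `e` and `i ≠ j` with `eᵢ, eⱼ` `g`-orthonormal, the frame Weyl
component equals the sectional curvature `K(eᵢ, eⱼ)` plus one — the pointwise identity turning the
Weyl bounds of the printed proof of Thm. 1.8 (pp. 12–13) into its sectional-curvature pinching.
[cite: LiQingShi2017, Thm. 1.8 (proof, pp. 12–13)] [cite: Besse1987, (1.116)–1.118] -/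
theorem IsPoincareEinsteinFilling.weylFrame_pair_eq (h : IsPoincareEinsteinFilling M g₀ N g)
    (x : N) (e : Fin 5 → TangentSpace (𝓡 5) x) {i j : Fin 5} (hij : i ≠ j)
    (hi : g.inner x (e i) (e i) = 1) (hj : g.inner x (e j) (e j) = 1)
    (hij0 : g.inner x (e i) (e j) = 0) :
    (ofRiemannian g).weylFrame x e i j j i =
      (ofRiemannian g).curvatureForm (ofRiemannian g).leviCivita x (e i) (e j) (e j) (e i) + 1 := by
  refine weylFrame_pair_of_ricci_eq_neg (ofRiemannian g) (isRiemannian_ofRiemannian g) (m := 5)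
    finrank_euclideanSpace_fin (by norm_num) (fun y X Y ↦ ?_) x (Fintype.card_fin 5) e hij hi hj
    hij0
  rw [h.ricci_apply y X Y]
  norm_num

/-- **Frame-wise Weyl bounds give the sectional pinching.** On a Poincaré–Einstein filling, if at
the point `x` every `g`-orthonormal `5`-frame has all Weyl components `|W_{ijkl}| ≤ ε`, then
`|Rm(X, Y, Y, X) + 1| ≤ ε` for every `g`-orthonormal pair `X, Y ∈ T_x N`: extend `(X, Y)` to an
orthonormal `5`-frame (`exists_isOrthonormalFrame_pair`) and use `W_{0110} = Rm(X,Y,Y,X) + 1`.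
[cite: LiQingShi2017, Thm. 1.8 (proof, pp. 12–13)] -/
theorem IsPoincareEinsteinFilling.abs_curvatureForm_add_one_le_of_weylFrame
    (h : IsPoincareEinsteinFilling M g₀ N g) {ε : ℝ} (x : N)
    (hW : ∀ e : Fin 5 → TangentSpace (𝓡 5) x, (ofRiemannian g).IsOrthonormalFrame x e →
      ∀ i j k l, |(ofRiemannian g).weylFrame x e i j k l| ≤ ε)
    {X Y : TangentSpace (𝓡 5) x} (hX : g.inner x X X = 1) (hY : g.inner x Y Y = 1)
    (hXY : g.inner x X Y = 0) :
    |(ofRiemannian g).curvatureForm (ofRiemannian g).leviCivita x X Y Y X + 1| ≤ ε := by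
  obtain ⟨e, he, he0, he1⟩ := (ofRiemannian g).exists_isOrthonormalFrame_pair
    (fun v hv ↦ isRiemannian_ofRiemannian g x v hv) (m := 3) finrank_euclideanSpace_fin
    (X := X) (Y := Y) hX hY hXY
  have h01 : (0 : Fin 5) ≠ 1 := by decide
  have hW01 := hW e he 0 1 1 0
  rw [h.weylFrame_pair_eq x e h01 (he.1 0) (he.1 1) (he.2 0 1 h01), he0, he1] at hW01
  exact hW01

end Filling

/-! ### The fact follows from the Weyl pinching its proof establishes -/

/-- **Reduction of Li–Qing–Shi's Thm. 1.8 (`n = 5`) to the output of its proof.** The printed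
proof (pp. 12–13) establishes, by the relative volume inequality (Thm. 1.5) and two pointed
compactness arguments, that the WEYL TENSOR of a conformally compact Einstein manifold is
uniformly small once the Yamabe constant of the conformal infinity is close to `Y(S⁴)`:
for every `ε > 0` there is `δ > 0` such that, under the literal hypotheses of
`liQingShi_pinching_five`, every orthonormal-frame component satisfies `|W_{ijkl}| ≤ ε` at every
point. Given that statement (hypothesis `H`), the fact follows from the pointwise identity
`W_{ijji} = K_{ij} + 1` of Einstein metrics with `Ric = -4 g`
(`IsPoincareEinsteinFilling.abs_curvatureForm_add_one_le_of_weylFrame`). The analytic input `H`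
is a hypothesis of this theorem, not a named fact.
[cite: LiQingShi2017, Thm. 1.8 (proof, pp. 12–13)] -/
theorem liQingShi_pinching_five_of_weyl
    (H : ∀ ε : ℝ, 0 < ε → ∃ δ : ℝ, 0 < δ ∧
      ∀ (M : Type) [TopologicalSpace M] [T2Space M] [SecondCountableTopology M]
        [ChartedSpace (EuclideanSpace ℝ (Fin 4)) M] [IsManifold (𝓡 4) ∞ M] [CompactSpace M]
        [ConnectedSpace M] [MeasurableSpace M] [BorelSpace M]
        (g₀ : Bundle.ContMDiffRiemannianMetric (𝓡 4) ∞ (EuclideanSpace ℝ (Fin 4))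
          (TangentSpace (𝓡 4) : M → Type _))
        (N : Type) [TopologicalSpace N] [T2Space N] [SecondCountableTopology N]
        [ChartedSpace (EuclideanSpace ℝ (Fin 5)) N] [IsManifold (𝓡 5) ∞ N]
        (g : Bundle.ContMDiffRiemannianMetric (𝓡 5) ∞ (EuclideanSpace ℝ (Fin 5))
          (TangentSpace (𝓡 5) : N → Type _))
        [(PseudoRiemannianMetric.ofRiemannian g).HasLeviCivita],
        IsPoincareEinsteinFilling M g₀ N g →
        (∀ (h : Bundle.ContMDiffRiemannianMetric (𝓡 4) ∞ (EuclideanSpace ℝ (Fin 4))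
            (TangentSpace (𝓡 4) : M → Type _))
            [(PseudoRiemannianMetric.ofRiemannian h).HasLeviCivita],
          IsConformalTo h g₀ →
            (1 - δ) * (8 * Real.sqrt 6 * Real.pi) *
                Real.sqrt ((riemannianMeasure h Set.univ).toReal) ≤
              ∫ x, (PseudoRiemannianMetric.ofRiemannian h).scalarCurvature x
                ∂(riemannianMeasure h)) →
        ∀ (x : N) (e : Fin 5 → TangentSpace (𝓡 5) x),
          (PseudoRiemannianMetric.ofRiemannian g).IsOrthonormalFrame x e →
          ∀ i j k l, |(PseudoRiemannianMetric.ofRiemannian g).weylFrame x e i j k l| ≤ ε) :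
    liQingShi_pinching_five := by
  intro ε hε
  obtain ⟨δ, hδ, Hδ⟩ := H ε hε
  refine ⟨δ, hδ, ?_⟩
  intro M _ _ _ _ _ _ _ _ _ g₀ N _ _ _ _ _ g _ hPE hY x X Y hX hY' hXY
  exact hPE.abs_curvatureForm_add_one_le_of_weylFrame x (Hδ M g₀ N g hPE hY x) hX hY' hXY

/-! ### Bookkeeping: small `ε` and small `δ` suffice -/

/-- The matrix of the fact is monotone in `ε` and antitone in `δ`: a `δ` that works for `ε`
works for every `ε' ≥ ε`, and any smaller positive `δ' ≤ δ` still works (its hypothesis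
`(1-δ') c √V ≤ ∫ R` implies `(1-δ) c √V ≤ ∫ R`). Hence it suffices to produce `δ` for `ε ≤ 1`,
and one may always take `δ ≤ 1`. [folklore] -/
theorem liQingShi_pinching_five_iff_small :
    liQingShi_pinching_five ↔
    ∀ ε : ℝ, 0 < ε → ε ≤ 1 → ∃ δ : ℝ, 0 < δ ∧ δ ≤ 1 ∧
    ∀ (M : Type) [TopologicalSpace M] [T2Space M] [SecondCountableTopology M]
      [ChartedSpace (EuclideanSpace ℝ (Fin 4)) M] [IsManifold (𝓡 4) ∞ M] [CompactSpace M]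
      [ConnectedSpace M] [MeasurableSpace M] [BorelSpace M]
      (g₀ : Bundle.ContMDiffRiemannianMetric (𝓡 4) ∞ (EuclideanSpace ℝ (Fin 4))
        (TangentSpace (𝓡 4) : M → Type _))
      (N : Type) [TopologicalSpace N] [T2Space N] [SecondCountableTopology N]
      [ChartedSpace (EuclideanSpace ℝ (Fin 5)) N] [IsManifold (𝓡 5) ∞ N]
      (g : Bundle.ContMDiffRiemannianMetric (𝓡 5) ∞ (EuclideanSpace ℝ (Fin 5))
        (TangentSpace (𝓡 5) : N → Type _))
      [(PseudoRiemannianMetric.ofRiemannian g).HasLeviCivita],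
      IsPoincareEinsteinFilling M g₀ N g →
      (∀ (h : Bundle.ContMDiffRiemannianMetric (𝓡 4) ∞ (EuclideanSpace ℝ (Fin 4))
          (TangentSpace (𝓡 4) : M → Type _))
          [(PseudoRiemannianMetric.ofRiemannian h).HasLeviCivita],
        IsConformalTo h g₀ →
          (1 - δ) * (8 * Real.sqrt 6 * Real.pi) *
              Real.sqrt ((riemannianMeasure h Set.univ).toReal) ≤
            ∫ x, (PseudoRiemannianMetric.ofRiemannian h).scalarCurvature x
              ∂(riemannianMeasure h)) →
      ∀ (x : N) (X Y : TangentSpace (𝓡 5) x), g.inner x X X = 1 → g.inner x Y Y = 1 →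
        g.inner x X Y = 0 →
        |(PseudoRiemannianMetric.ofRiemannian g).curvatureForm
            (PseudoRiemannianMetric.ofRiemannian g).leviCivita x X Y Y X + 1| ≤ ε := by
  constructor
  · intro hLQS ε hε _
    obtain ⟨δ, hδ, H⟩ := hLQS ε hε
    refine ⟨min δ 1, lt_min hδ one_pos, min_le_right _ _, ?_⟩
    intro M _ _ _ _ _ _ _ _ _ g₀ N _ _ _ _ _ g _ hPE hY
    refine H M g₀ N g hPE fun h _ hconf ↦ ?_
    have hh := hY h hconf
    have hc : 0 ≤ 8 * Real.sqrt 6 * Real.pi * Real.sqrt ((riemannianMeasure h Set.univ).toReal) :=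
      by positivity
    nlinarith [min_le_left δ 1]
  · intro H ε hε
    obtain ⟨δ, hδ, -, Hδ⟩ := H (min ε 1) (lt_min hε one_pos) (min_le_right _ _)
    refine ⟨δ, hδ, ?_⟩
    intro M _ _ _ _ _ _ _ _ _ g₀ N _ _ _ _ _ g _ hPE hY x X Y hX hY' hXY
    exact (Hδ M g₀ N g hPE hY x X Y hX hY' hXY).trans (min_le_left _ _)

/-! ### The fact in the tree's Yamabe-constant vocabulary -/

namespace liQingShi_pinching_five

/-- **Thm. 1.8 with the hypothesis `Y(M, [g₀]) ≥ (1 - δ) Y(S⁴, [g_S])` written with the tree's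
`yamabeConstant`** (`YamabeConstant.lean`: `Y(M,[g₀]) = inf_{h ∈ [g₀]} ∫_M R_h dV_h / √Vol(M,h)`
in dimension `4`): from the fact, for every `ε > 0` there is `δ > 0` such that a Poincaré–Einstein
filling of `(M, [g₀])` with `(1 - δ)·8√6π ≤ yamabeConstant g₀` has `|K + 1| ≤ ε`, provided the
Yamabe functional is bounded below on `[g₀]` and every metric of the class has positive volume
(both hold on a closed manifold — Lee–Parker 1987, §1 — and are hypotheses here exactly as in
`yamabeConstant_le` / `le_yamabeQuotient_iff_mul_sqrt_le`). [cite: LiQingShi2017, Thm. 1.8 (p. 4)]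
[cite: LeeParker1987, §1 (1.5)] -/
theorem of_yamabeConstant_ge (hLQS : liQingShi_pinching_five) :
    ∀ ε : ℝ, 0 < ε → ∃ δ : ℝ, 0 < δ ∧
    ∀ (M : Type) [TopologicalSpace M] [T2Space M] [SecondCountableTopology M]
      [ChartedSpace (EuclideanSpace ℝ (Fin 4)) M] [IsManifold (𝓡 4) ∞ M] [CompactSpace M]
      [ConnectedSpace M] [MeasurableSpace M] [BorelSpace M]
      (g₀ : Bundle.ContMDiffRiemannianMetric (𝓡 4) ∞ (EuclideanSpace ℝ (Fin 4))
        (TangentSpace (𝓡 4) : M → Type _))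
      (N : Type) [TopologicalSpace N] [T2Space N] [SecondCountableTopology N]
      [ChartedSpace (EuclideanSpace ℝ (Fin 5)) N] [IsManifold (𝓡 5) ∞ N]
      (g : Bundle.ContMDiffRiemannianMetric (𝓡 5) ∞ (EuclideanSpace ℝ (Fin 5))
        (TangentSpace (𝓡 5) : N → Type _))
      [(PseudoRiemannianMetric.ofRiemannian g).HasLeviCivita],
      IsPoincareEinsteinFilling M g₀ N g →
      BddBelow (yamabeQuotients g₀) →
      (∀ h : Bundle.ContMDiffRiemannianMetric (𝓡 4) ∞ (EuclideanSpace ℝ (Fin 4))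
          (TangentSpace (𝓡 4) : M → Type _),
        IsConformalTo h g₀ → 0 < (riemannianMeasure h Set.univ).toReal) →
      (1 - δ) * (8 * Real.sqrt 6 * Real.pi) ≤ yamabeConstant g₀ →
      ∀ (x : N) (X Y : TangentSpace (𝓡 5) x), g.inner x X X = 1 → g.inner x Y Y = 1 →
        g.inner x X Y = 0 →
        |(PseudoRiemannianMetric.ofRiemannian g).curvatureForm
            (PseudoRiemannianMetric.ofRiemannian g).leviCivita x X Y Y X + 1| ≤ ε := by
  intro ε hε
  obtain ⟨δ, hδ, H⟩ := hLQS ε hε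
  refine ⟨δ, hδ, ?_⟩
  intro M _ _ _ _ _ _ _ _ _ g₀ N _ _ _ _ _ g _ hPE hbdd hvol hYam
  refine H M g₀ N g hPE fun h _ hconf ↦ ?_
  have hq : (1 - δ) * (8 * Real.sqrt 6 * Real.pi) ≤ yamabeQuotient h :=
    hYam.trans (yamabeConstant_le hbdd h hconf)
  exact (le_yamabeQuotient_iff_mul_sqrt_le finrank_euclideanSpace_fin h (hvol h hconf) _).1 hq

end liQingShi_pinching_five

/-! ### The model case: hyperbolic space satisfies the conclusion with `ε = 0` -/

namespace Hyperboloid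

variable {V : Type*} [NormedAddCommGroup V] [InnerProductSpace ℝ V] [FiniteDimensional ℝ V]
  {U : TopologicalSpace.Opens V}

/-- **Hyperbolic space is the equality case of the pinching**: for the hyperbolic metric
(`Hyperboloid.metric U`, constant sectional curvature `-1`, Lee 2018, Thm. 8.34 (c)) every
`g`-orthonormal pair has `Rm(X, Y, Y, X) + 1 = 0`, i.e. `K ≡ -1` in the slot and sign conventions
of `liQingShi_pinching_five` (`Rm(X,Y,Z,W) = g(R(X,Y)Z, W)`,
`R(X,Y) = ∇_X ∇_Y - ∇_Y ∇_X - ∇_{[X,Y]}`) — the conformally compact Einstein manifold with round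
conformal infinity, around which Thm. 1.8 pinches. [cite: Lee2018, Thm. 8.34 (c)] -/
theorem curvatureForm_pair_add_one [(metric U).HasLeviCivita] (x : U) {X Y : V}
    (hX : (metric U).val x X X = 1) (hY : (metric U).val x Y Y = 1)
    (hXY : (metric U).val x X Y = 0) :
    (metric U).curvatureForm (metric U).leviCivita x X Y Y X + 1 = 0 := by
  rw [(hasConstantSectionalCurvatureWith_leviCivita (U := U)).curvatureForm_pair x X Y, hX, hY,
    hXY]
  ring

/-- Consequently `|Rm(X, Y, Y, X) + 1| ≤ ε` holds on hyperbolic space for every `ε ≥ 0`.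
[cite: Lee2018, Thm. 8.34 (c)] -/
theorem abs_curvatureForm_pair_add_one_le [(metric U).HasLeviCivita] {ε : ℝ} (hε : 0 ≤ ε)
    (x : U) {X Y : V} (hX : (metric U).val x X X = 1) (hY : (metric U).val x Y Y = 1)
    (hXY : (metric U).val x X Y = 0) :
    |(metric U).curvatureForm (metric U).leviCivita x X Y Y X + 1| ≤ ε := by
  rw [curvatureForm_pair_add_one x hX hY hXY, abs_zero]
  exact hε

end Hyperboloid

/-! ### The converse: sectional pinching bounds the Weyl tensor -/

section WeylConverse

variable {M : Type} [TopologicalSpace M] [ChartedSpace (EuclideanSpace ℝ (Fin 4)) M]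
  [IsManifold (𝓡 4) ∞ M]
  {g₀ : Bundle.ContMDiffRiemannianMetric (𝓡 4) ∞ (EuclideanSpace ℝ (Fin 4))
    (TangentSpace (𝓡 4) : M → Type _)}
  {N : Type} [TopologicalSpace N] [ChartedSpace (EuclideanSpace ℝ (Fin 5)) N]
  [IsManifold (𝓡 5) ∞ N]
  {g : Bundle.ContMDiffRiemannianMetric (𝓡 5) ∞ (EuclideanSpace ℝ (Fin 5))
    (TangentSpace (𝓡 5) : N → Type _)}
  [(PseudoRiemannianMetric.ofRiemannian g).HasLeviCivita]

/-- **The Weyl tensor of a Poincaré–Einstein filling is the deviation of its curvature tensor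
from the hyperbolic one**: in every `g`-orthonormal `5`-frame,
`W_{ijkl} = Rm_{ijkl} + (δ_il δ_jk - δ_ik δ_jl) = Rm_{ijkl} - (Rm_{ℍ})_{ijkl}`, where
`Rm_ℍ(X,Y,Z,W) = -(g(Y,Z) g(X,W) - g(X,Z) g(Y,W))` is the constant-curvature-`-1` tensor
(Lee 2018, Prop. 8.36): with `Ric = -4 δ`, `S = -20` the Ricci and scalar corrections of
`weylFrame` add up to `(8/3 - 5/3)(δ_il δ_jk - δ_ik δ_jl)` (Besse 1987, (1.116)–1.118: the Weyl
part of an Einstein curvature tensor is `R - (s/(2m(m-1))) g ⊙ g`).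
[cite: Besse1987, (1.116)–1.118] [cite: Lee2018, Prop. 8.36] -/
theorem IsPoincareEinsteinFilling.weylFrame_eq_of_isOrthonormalFrame
    (h : IsPoincareEinsteinFilling M g₀ N g) (x : N) {e : Fin 5 → TangentSpace (𝓡 5) x}
    (he : (ofRiemannian g).IsOrthonormalFrame x e) (i j k l : Fin 5) :
    (ofRiemannian g).weylFrame x e i j k l =
      (ofRiemannian g).curvatureForm (ofRiemannian g).leviCivita x (e i) (e j) (e k) (e l) +
        ((if i = l then 1 else 0) * (if j = k then 1 else 0) -
          (if i = k then 1 else 0) * (if j = l then 1 else 0)) := by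
  have hδ : ∀ a b : Fin 5, (ofRiemannian g).val x (e a) (e b) = if a = b then 1 else 0 := by
    intro a b
    by_cases hab : a = b
    · subst hab; rw [if_pos rfl]; exact he.1 a
    · rw [if_neg hab]; exact he.2 a b hab
  rw [weylFrame_apply, Fintype.card_fin, h.scalarCurvature_eq x]
  simp only [h.ricci_apply, hδ]
  push_cast
  ring

/-- **Sectional pinching of a Poincaré–Einstein filling bounds its Weyl tensor**: if at `x` every
`g`-orthonormal pair has `|Rm(X,Y,Y,X) + 1| ≤ ε` (`0 ≤ ε`), then every component of the Weyl
tensor in every `g`-orthonormal `5`-frame at `x` satisfies `|W_{ijkl}| ≤ 8ε` — the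
Berger–Karcher-type estimate `abs_curvatureForm_frame_sub_le` (`SectionalPinchingEstimate.lean`,
pinching constant `c = -1`) for the Levi-Civita connection of `g`
(`isLeviCivita_leviCivita_holds`), read through `weylFrame_eq_of_isOrthonormalFrame`.
[folklore] -/
theorem IsPoincareEinsteinFilling.abs_weylFrame_le_of_pinching
    (h : IsPoincareEinsteinFilling M g₀ N g) {ε : ℝ} (hε : 0 ≤ ε) (x : N)
    (hK : ∀ X Y : TangentSpace (𝓡 5) x, g.inner x X X = 1 → g.inner x Y Y = 1 →
      g.inner x X Y = 0 →
      |(ofRiemannian g).curvatureForm (ofRiemannian g).leviCivita x X Y Y X + 1| ≤ ε)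
    {e : Fin 5 → TangentSpace (𝓡 5) x} (he : (ofRiemannian g).IsOrthonormalFrame x e)
    (i j k l : Fin 5) :
    |(ofRiemannian g).weylFrame x e i j k l| ≤ 8 * ε := by
  have hLC : (ofRiemannian g).IsLeviCivita (ofRiemannian g).leviCivita :=
    isLeviCivita_leviCivita_holds
  have h2 : (2 : ℕ∞ω) ≤ ((⊤ : ℕ∞) : ℕ∞ω) := WithTop.coe_le_coe.mpr le_top
  have hK' : ∀ X Y : TangentSpace (𝓡 5) x, (ofRiemannian g).val x X X = 1 →
      (ofRiemannian g).val x Y Y = 1 → (ofRiemannian g).val x X Y = 0 →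
      |(ofRiemannian g).curvatureForm (ofRiemannian g).leviCivita x X Y Y X - (-1)| ≤ ε :=
    fun X Y hX hY hXY ↦ by rw [sub_neg_eq_add]; exact hK X Y hX hY hXY
  have hb := abs_curvatureForm_frame_sub_le hLC h2
    (fun v hv ↦ isRiemannian_ofRiemannian g x v hv) hε hK' he i j k l
  rw [h.weylFrame_eq_of_isOrthonormalFrame x he i j k l]
  rwa [neg_one_mul, sub_neg_eq_add] at hb

end WeylConverse

/-- **Li–Qing–Shi's Thm. 1.8 (`n = 5`) implies its Weyl form**: from the fact, for every `ε > 0`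
there is `δ > 0` such that every Poincaré–Einstein filling with `Y(M,[g₀]) ≥ (1-δ)·8√6π` has
all orthonormal-frame Weyl components `|W_{ijkl}| ≤ ε` at every point (apply the fact with
`ε/8` and `IsPoincareEinsteinFilling.abs_weylFrame_le_of_pinching`).
[cite: LiQingShi2017, Thm. 1.8 (proof, pp. 12–13)] -/
theorem weyl_of_liQingShi_pinching_five (hLQS : liQingShi_pinching_five) :
    ∀ ε : ℝ, 0 < ε → ∃ δ : ℝ, 0 < δ ∧
      ∀ (M : Type) [TopologicalSpace M] [T2Space M] [SecondCountableTopology M]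
        [ChartedSpace (EuclideanSpace ℝ (Fin 4)) M] [IsManifold (𝓡 4) ∞ M] [CompactSpace M]
        [ConnectedSpace M] [MeasurableSpace M] [BorelSpace M]
        (g₀ : Bundle.ContMDiffRiemannianMetric (𝓡 4) ∞ (EuclideanSpace ℝ (Fin 4))
          (TangentSpace (𝓡 4) : M → Type _))
        (N : Type) [TopologicalSpace N] [T2Space N] [SecondCountableTopology N]
        [ChartedSpace (EuclideanSpace ℝ (Fin 5)) N] [IsManifold (𝓡 5) ∞ N]
        (g : Bundle.ContMDiffRiemannianMetric (𝓡 5) ∞ (EuclideanSpace ℝ (Fin 5))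
          (TangentSpace (𝓡 5) : N → Type _))
        [(PseudoRiemannianMetric.ofRiemannian g).HasLeviCivita],
        IsPoincareEinsteinFilling M g₀ N g →
        (∀ (h : Bundle.ContMDiffRiemannianMetric (𝓡 4) ∞ (EuclideanSpace ℝ (Fin 4))
            (TangentSpace (𝓡 4) : M → Type _))
            [(PseudoRiemannianMetric.ofRiemannian h).HasLeviCivita],
          IsConformalTo h g₀ →
            (1 - δ) * (8 * Real.sqrt 6 * Real.pi) *
                Real.sqrt ((riemannianMeasure h Set.univ).toReal) ≤
              ∫ x, (PseudoRiemannianMetric.ofRiemannian h).scalarCurvature x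
                ∂(riemannianMeasure h)) →
        ∀ (x : N) (e : Fin 5 → TangentSpace (𝓡 5) x),
          (PseudoRiemannianMetric.ofRiemannian g).IsOrthonormalFrame x e →
          ∀ i j k l, |(PseudoRiemannianMetric.ofRiemannian g).weylFrame x e i j k l| ≤ ε := by
  intro ε hε
  obtain ⟨δ, hδ, H⟩ := hLQS (ε / 8) (by positivity)
  refine ⟨δ, hδ, ?_⟩
  intro M _ _ _ _ _ _ _ _ _ g₀ N _ _ _ _ _ g _ hPE hY x e he i j k l
  have hb := hPE.abs_weylFrame_le_of_pinching (by positivity : (0 : ℝ) ≤ ε / 8) x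
    (H M g₀ N g hPE hY x) he i j k l
  linarith

/-- **`liQingShi_pinching_five` is equivalent to its Weyl form** — the statement that the printed
proof of Li–Qing–Shi 2017, Thm. 1.8 actually establishes by Thm. 1.5 and the two pointed
compactness arguments of pp. 12–13 ("`|W|[g⁺] ≤ C`", then "`|W|(p_j) ≥ ε₀` … produces a
contradiction"): for every `ε > 0` there is `δ > 0` such that every Poincaré–Einstein filling
`(N⁵, g)` of a closed `(M⁴, [g₀])` with `(1-δ)·8√6π·√Vol(M,h) ≤ ∫_M R_h dV_h` for all `h ∈ [g₀]`
has `|W_{ijkl}| ≤ ε` in every `g`-orthonormal `5`-frame at every point. (`→`: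
`weyl_of_liQingShi_pinching_five`, the Berger–Karcher-type estimate; `←`:
`liQingShi_pinching_five_of_weyl`, `W_{ijji} = K_{ij} + 1`.)
[cite: LiQingShi2017, Thm. 1.8 (proof, pp. 12–13)] -/
theorem liQingShi_pinching_five_iff_weyl :
    liQingShi_pinching_five ↔
    ∀ ε : ℝ, 0 < ε → ∃ δ : ℝ, 0 < δ ∧
      ∀ (M : Type) [TopologicalSpace M] [T2Space M] [SecondCountableTopology M]
        [ChartedSpace (EuclideanSpace ℝ (Fin 4)) M] [IsManifold (𝓡 4) ∞ M] [CompactSpace M]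
        [ConnectedSpace M] [MeasurableSpace M] [BorelSpace M]
        (g₀ : Bundle.ContMDiffRiemannianMetric (𝓡 4) ∞ (EuclideanSpace ℝ (Fin 4))
          (TangentSpace (𝓡 4) : M → Type _))
        (N : Type) [TopologicalSpace N] [T2Space N] [SecondCountableTopology N]
        [ChartedSpace (EuclideanSpace ℝ (Fin 5)) N] [IsManifold (𝓡 5) ∞ N]
        (g : Bundle.ContMDiffRiemannianMetric (𝓡 5) ∞ (EuclideanSpace ℝ (Fin 5))
          (TangentSpace (𝓡 5) : N → Type _))
        [(PseudoRiemannianMetric.ofRiemannian g).HasLeviCivita],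
        IsPoincareEinsteinFilling M g₀ N g →
        (∀ (h : Bundle.ContMDiffRiemannianMetric (𝓡 4) ∞ (EuclideanSpace ℝ (Fin 4))
            (TangentSpace (𝓡 4) : M → Type _))
            [(PseudoRiemannianMetric.ofRiemannian h).HasLeviCivita],
          IsConformalTo h g₀ →
            (1 - δ) * (8 * Real.sqrt 6 * Real.pi) *
                Real.sqrt ((riemannianMeasure h Set.univ).toReal) ≤
              ∫ x, (PseudoRiemannianMetric.ofRiemannian h).scalarCurvature x
                ∂(riemannianMeasure h)) →
        ∀ (x : N) (e : Fin 5 → TangentSpace (𝓡 5) x),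
          (PseudoRiemannianMetric.ofRiemannian g).IsOrthonormalFrame x e →
          ∀ i j k l, |(PseudoRiemannianMetric.ofRiemannian g).weylFrame x e i j k l| ≤ ε :=
  ⟨weyl_of_liQingShi_pinching_five, liQingShi_pinching_five_of_weyl⟩

end Literature.Geometry.Riemannian

end
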